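import Mathlib
import HarnessLib
import Literature.Analysis.SpecialFunctions.LaguerrePolynomial
import Literature.Combinatorics.Enumerative.HermiteBilinearGeneratingFunction
import Literature.Analysis.Quadrature.GaussLaguerreHermiteLowOrder

/-!
# Use of Laguerre and Hermite expansions for Fourier integrals on infinite intervals
(Davis–Rabinowitz 1984, Sect. 3.9.1)

Davis–Rabinowitz, *Methods of Numerical Integration* (2nd ed., 1984), Sect. 3.9 "Oscillatory
integrands" on `[0, ∞)` and `(-∞, ∞)`, Sect. 3.9.1 "Use of Laguerre and Hermite Expansions"
(Patterson's method).  The Fourier transforms of the Laguerre and Hermite polynomials times their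
weights are known in closed form,

* (3.9.1.1) `V_k(w) = (k!/Γ(k+1+α)) ∫_0^∞ x^α e^{-x} L_k^{(α)}(x) e^{iwx} dx
             = i^{1+α} w^k ((w - i)/(1 + w²))^{k+1+α}`,
* (3.9.1.2) `U_k(w) = ∫_{-∞}^{∞} e^{-x²} H_k(x) e^{iwx} dx = i^k π^{1/2} w^k e^{-w²/4}`,

so that expanding `f` in Laguerre / Hermite polynomials, (3.9.1.5)–(3.9.1.6) resp.
(3.9.1.8)–(3.9.1.9), turns the Fourier integrals `L(w) = ∫_0^∞ x^α e^{-x} f(x) e^{iwx} dx`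
(3.9.1.3) and `H(w) = ∫ e^{-x²} f(x) e^{iwx} dx` (3.9.1.4) into the finite sums (3.9.1.7) and
(3.9.1.10).  For `α = 0` the real and imaginary parts give `I_c ≈ Σ b_k C_k`, `I_s ≈ Σ b_k S_k`
(3.9.1.11)–(3.9.1.12) with the recursion `C_0 = 1/(1+w²)`, `S_0 = w C_0`,
`C_k = S_0 (w C_{k-1} + S_{k-1})`, `S_k = S_0 (w S_{k-1} - C_{k-1})`.

What is formalised here:

* the objects: the generalized Laguerre polynomials `laguerre α k` and the physicists' Hermite
  polynomials `physHermite` (both imported from the tree), `laguerreFourierL` (3.9.1.3), `hermiteFourierH`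
  (3.9.1.4), the closed forms `laguerreFourierV` / `hermiteFourierU`, the coefficients
  `laguerreExpansionCoeff` (3.9.1.6) / `hermiteExpansionCoeff` (3.9.1.9), Patterson's approximations
  `pattersonLaguerreApprox` (3.9.1.7) / `pattersonHermiteApprox` (3.9.1.10), and the recursion
  `pattersonCS` for `(C_k, S_k)`;
* the closed forms (3.9.1.1), (3.9.1.2) for general `k` as NAMED FACTS `LaguerreFourierClosedForm`,
  `HermiteFourierClosedForm` (`def … : Prop`, to be used as hypotheses; the text quotes them);
* PROVED instances: (3.9.1.1) at `α = 0`, `k = 0` (`laguerreFourierClosedForm_zero_zero`: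
  `∫_0^∞ e^{-x} e^{iwx} dx = 1/(1 - iw) = i (w - i)/(1 + w²)`), (3.9.1.2) at `k = 0`
  (`hermiteFourierClosedForm_zero`, the Gaussian Fourier transform) and at `k = 1`
  (`hermiteFourierClosedForm_one`, by `∫ (d/dx) = 0`);
* PROVED: the recursion `(C_k, S_k)` reproduces the real and imaginary parts of `V_k(w)` at
  `α = 0`, i.e. `C_k + i S_k = i w^k ((w - i)/(1 + w²))^{k+1}` (`pattersonCS_eq`), whence
  (3.9.1.11)–(3.9.1.12) are the real and imaginary parts of (3.9.1.7)
  (`pattersonLaguerreApprox_zero_eq`).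

* PROVED (appended section, `HermiteFourierClosedForm_holds`): (3.9.1.2) for every `k`, by
  induction via `U_{k+1}(w) = iw U_k(w)` (integration by parts with
  `H_{k+1} = -e^{x²} (e^{-x²} H_k)'`).

Not formalised: the proof of (3.9.1.1) for general `k`, the splitting (3.9.1.13) and
Patterson's numerical example.
-/

open MeasureTheory Set Finset
open scoped BigOperators

namespace Literature.Analysis.Quadrature

open Literature.Combinatorics.Enumerative.HermiteBilinearGeneratingFunction
  (physHermite physHermite_zero physHermite_one)
open Literature.Analysis.SpecialFunctions (laguerre laguerre_zero)

/-! ## Patterson's recursion for `α = 0` -/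

/-- The pair `(C_k, S_k)`: `C_0 = 1/(1+w²)`, `S_0 = w C_0`, `C_k = S_0 (w C_{k-1} + S_{k-1})`,
`S_k = S_0 (w S_{k-1} - C_{k-1})`. [cite: DavisRabinowitz1984, Sect. 3.9.1 (3.9.1.12)] -/
noncomputable def pattersonCS (w : ℝ) : ℕ → ℝ × ℝ
  | 0 => (1 / (1 + w ^ 2), w / (1 + w ^ 2))
  | k + 1 =>
    ((w / (1 + w ^ 2)) * (w * (pattersonCS w k).1 + (pattersonCS w k).2),
     (w / (1 + w ^ 2)) * (w * (pattersonCS w k).2 - (pattersonCS w k).1))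

/-- `C_k`. [cite: DavisRabinowitz1984, Sect. 3.9.1 (3.9.1.11)] -/
noncomputable def pattersonC (w : ℝ) (k : ℕ) : ℝ := (pattersonCS w k).1

/-- `S_k`. [cite: DavisRabinowitz1984, Sect. 3.9.1 (3.9.1.12)] -/
noncomputable def pattersonS (w : ℝ) (k : ℕ) : ℝ := (pattersonCS w k).2

/-- `C_0 = 1/(1+w²)`. [cite: DavisRabinowitz1984, Sect. 3.9.1 (3.9.1.12)] -/
theorem pattersonC_zero (w : ℝ) : pattersonC w 0 = 1 / (1 + w ^ 2) := rfl

/-- `S_0 = w C_0`. [cite: DavisRabinowitz1984, Sect. 3.9.1 (3.9.1.12)] -/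
theorem pattersonS_zero (w : ℝ) : pattersonS w 0 = w * pattersonC w 0 := by
  show w / (1 + w ^ 2) = w * (1 / (1 + w ^ 2)); ring

/-- `S_0 = w/(1+w²)`. [cite: DavisRabinowitz1984, Sect. 3.9.1 (3.9.1.12)] -/
theorem pattersonS_zero' (w : ℝ) : pattersonS w 0 = w / (1 + w ^ 2) := rfl

/-- `C_k = S_0 (w C_{k-1} + S_{k-1})`. [cite: DavisRabinowitz1984, Sect. 3.9.1 (3.9.1.12)] -/
theorem pattersonC_succ (w : ℝ) (k : ℕ) :
    pattersonC w (k + 1) = pattersonS w 0 * (w * pattersonC w k + pattersonS w k) := rfl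

/-- `S_k = S_0 (w S_{k-1} - C_{k-1})`. [cite: DavisRabinowitz1984, Sect. 3.9.1 (3.9.1.12)] -/
theorem pattersonS_succ (w : ℝ) (k : ℕ) :
    pattersonS w (k + 1) = pattersonS w 0 * (w * pattersonS w k - pattersonC w k) := rfl

/-- One step of the recursion in complex form: `C_{k+1} + i S_{k+1} = S_0 (w - i) (C_k + i S_k)`.
[cite: DavisRabinowitz1984, Sect. 3.9.1 (3.9.1.12)] -/
theorem pattersonCS_succ_complex (w : ℝ) (k : ℕ) :
    (pattersonC w (k + 1) : ℂ) + Complex.I * (pattersonS w (k + 1) : ℂ)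
      = (pattersonS w 0 : ℂ) * ((w : ℂ) - Complex.I)
          * ((pattersonC w k : ℂ) + Complex.I * (pattersonS w k : ℂ)) := by
  rw [pattersonC_succ, pattersonS_succ]
  push_cast
  linear_combination ((pattersonS w 0 : ℂ) * (pattersonS w k : ℂ)) * Complex.I_sq

/-- **The recursion reproduces (3.9.1.1) at `α = 0`**: `C_k + i S_k = i w^k ((w - i)/(1 + w²))^{k+1}
= V_k(w)`, so `C_k = Re V_k(w)` and `S_k = Im V_k(w)`.
[cite: DavisRabinowitz1984, Sect. 3.9.1 (3.9.1.11)-(3.9.1.12)] -/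
theorem pattersonCS_eq (w : ℝ) (k : ℕ) :
    (pattersonC w k : ℂ) + Complex.I * (pattersonS w k : ℂ)
      = Complex.I * (w : ℂ) ^ k * (((w : ℂ) - Complex.I) / (1 + (w : ℂ) ^ 2)) ^ (k + 1) := by
  have hw : (1 + (w : ℂ) ^ 2) ≠ 0 := by
    have : (1 + (w : ℂ) ^ 2) = ((1 + w ^ 2 : ℝ) : ℂ) := by push_cast; ring
    rw [this, Ne, Complex.ofReal_eq_zero]; positivity
  induction k with
  | zero =>
    rw [pattersonC_zero, pattersonS_zero', pow_zero, mul_one, zero_add, pow_one]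
    push_cast
    linear_combination (1 / (1 + (w : ℂ) ^ 2)) * Complex.I_sq
  | succ k ih =>
    rw [pattersonCS_succ_complex, ih, pattersonS_zero']
    push_cast
    ring

/-! ## The Fourier integrals and the closed forms -/

/-- `L(w) = ∫_0^∞ x^α e^{-x} f(x) e^{iwx} dx` (3.9.1.3).
[cite: DavisRabinowitz1984, Sect. 3.9.1 (3.9.1.3)] -/
noncomputable def laguerreFourierL (α : ℝ) (f : ℝ → ℝ) (w : ℝ) : ℂ :=
  ∫ x in Ioi (0 : ℝ), ((x ^ α * Real.exp (-x) * f x : ℝ) : ℂ) * Complex.exp (Complex.I * w * x)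

/-- `H(w) = ∫_{-∞}^{∞} e^{-x²} f(x) e^{iwx} dx` (3.9.1.4).
[cite: DavisRabinowitz1984, Sect. 3.9.1 (3.9.1.4)] -/
noncomputable def hermiteFourierH (f : ℝ → ℝ) (w : ℝ) : ℂ :=
  ∫ x : ℝ, ((Real.exp (-x ^ 2) * f x : ℝ) : ℂ) * Complex.exp (Complex.I * w * x)

/-- The closed form `V_k(w) = i^{1+α} w^k ((w - i)/(1 + w²))^{k+1+α}` of (3.9.1.1) (complex powers
in Mathlib's principal-branch convention). [cite: DavisRabinowitz1984, Sect. 3.9.1 (3.9.1.1)] -/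
noncomputable def laguerreFourierV (α : ℝ) (k : ℕ) (w : ℝ) : ℂ :=
  Complex.I ^ ((1 : ℂ) + α) * (w : ℂ) ^ k *
    (((w : ℂ) - Complex.I) / (1 + (w : ℂ) ^ 2)) ^ ((k : ℂ) + 1 + α)

/-- The closed form `U_k(w) = i^k π^{1/2} w^k e^{-w²/4}` of (3.9.1.2).
[cite: DavisRabinowitz1984, Sect. 3.9.1 (3.9.1.2)] -/
noncomputable def hermiteFourierU (k : ℕ) (w : ℝ) : ℂ :=
  Complex.I ^ k * (Real.pi : ℂ) ^ (1 / 2 : ℂ) * (w : ℂ) ^ k * Complex.exp (-(w : ℂ) ^ 2 / 4)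

/-- NAMED FACT (3.9.1.1): `(k!/Γ(k+1+α)) ∫_0^∞ x^α e^{-x} L_k^{(α)}(x) e^{iwx} dx = V_k(w)`
(quoted by the text; proved below for `α = 0`, `k = 0`).
[cite: DavisRabinowitz1984, Sect. 3.9.1 (3.9.1.1)] -/
def LaguerreFourierClosedForm (α : ℝ) (k : ℕ) (w : ℝ) : Prop :=
  ((k.factorial : ℝ) / Real.Gamma (k + 1 + α) : ℂ) * laguerreFourierL α (fun x => (laguerre α k).eval x) w
    = laguerreFourierV α k w

/-- NAMED FACT (3.9.1.2): `∫ e^{-x²} H_k(x) e^{iwx} dx = U_k(w)` (quoted by the text; proved below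
for `k = 0, 1`, and for every `k` at the end of the file: `HermiteFourierClosedForm_holds`).
[cite: DavisRabinowitz1984, Sect. 3.9.1 (3.9.1.2)] -/
def HermiteFourierClosedForm (k : ℕ) (w : ℝ) : Prop :=
  hermiteFourierH (fun x => (physHermite ℝ k).eval x) w = hermiteFourierU k w

/-- At `α = 0` the closed form is `V_k(w) = i w^k ((w - i)/(1 + w²))^{k+1}` (natural powers).
[cite: DavisRabinowitz1984, Sect. 3.9.1 (3.9.1.1)] -/
theorem laguerreFourierV_zero_alpha (k : ℕ) (w : ℝ) :
    laguerreFourierV 0 k w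
      = Complex.I * (w : ℂ) ^ k * (((w : ℂ) - Complex.I) / (1 + (w : ℂ) ^ 2)) ^ (k + 1) := by
  simp only [laguerreFourierV, Complex.ofReal_zero, add_zero, Complex.cpow_one]
  congr 1
  exact_mod_cast Complex.cpow_natCast _ (k + 1)

/-- `1/(1 - iw) = i (w - i)/(1 + w²)`: the two ways of writing `V_0(w)` at `α = 0`.
[cite: DavisRabinowitz1984, Sect. 3.9.1 (3.9.1.1)] -/
theorem one_div_one_sub_I_mul (w : ℝ) :
    (1 : ℂ) / (1 - Complex.I * w) = Complex.I * (((w : ℂ) - Complex.I) / (1 + (w : ℂ) ^ 2)) := by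
  have hw : (1 + (w : ℂ) ^ 2) ≠ 0 := by
    have : (1 + (w : ℂ) ^ 2) = ((1 + w ^ 2 : ℝ) : ℂ) := by push_cast; ring
    rw [this, Ne, Complex.ofReal_eq_zero]; positivity
  have h1 : (1 - Complex.I * w) ≠ 0 := by
    intro h; have := congrArg Complex.re h; simp at this
  have key : Complex.I * ((w : ℂ) - Complex.I) * (1 - Complex.I * w) = 1 + (w : ℂ) ^ 2 := by
    linear_combination (-(w : ℂ) ^ 2 - 1 + Complex.I * w) * Complex.I_sq
  rw [div_eq_iff h1, mul_div_assoc', div_mul_eq_mul_div, key, div_self hw]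

/-- **(3.9.1.1) at `α = 0`, `k = 0`, the integral itself**: `∫_0^∞ e^{-x} e^{iwx} dx = 1/(1 - iw)`.
[cite: DavisRabinowitz1984, Sect. 3.9.1 (3.9.1.1)] -/
theorem integral_exp_neg_mul_cexp (w : ℝ) :
    ∫ x in Ioi (0 : ℝ), ((Real.exp (-x) : ℝ) : ℂ) * Complex.exp (Complex.I * w * x)
      = 1 / (1 - Complex.I * w) := by
  have ha : (Complex.I * w - 1).re < 0 := by simp
  have h1 : (1 - Complex.I * w) ≠ 0 := by
    intro h; have := congrArg Complex.re h; simp at this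
  have h2 : (Complex.I * w - 1) ≠ 0 := by
    intro h; have := congrArg Complex.re h; simp at this
  have : (fun x : ℝ => ((Real.exp (-x) : ℝ) : ℂ) * Complex.exp (Complex.I * w * x))
      = fun x : ℝ => Complex.exp ((Complex.I * w - 1) * x) := by
    funext x
    rw [Complex.ofReal_exp, ← Complex.exp_add]
    congr 1; push_cast; ring
  rw [this, integral_exp_mul_complex_Ioi ha 0]
  simp only [Complex.ofReal_zero, mul_zero, Complex.exp_zero]
  field_simp
  ring

/-- **(3.9.1.1) proved at `α = 0`, `k = 0`**: `V_0(w) = ∫_0^∞ e^{-x} e^{iwx} dx`.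
[cite: DavisRabinowitz1984, Sect. 3.9.1 (3.9.1.1)] -/
theorem laguerreFourierClosedForm_zero_zero (w : ℝ) : LaguerreFourierClosedForm 0 0 w := by
  unfold LaguerreFourierClosedForm
  have hL : laguerreFourierL 0 (fun x => (laguerre 0 0).eval x) w = 1 / (1 - Complex.I * w) := by
    rw [← integral_exp_neg_mul_cexp w]
    unfold laguerreFourierL
    refine setIntegral_congr_fun measurableSet_Ioi (fun x _ => ?_)
    simp only [laguerre_zero, Polynomial.eval_one, Real.rpow_zero, mul_one, one_mul]
  rw [hL, laguerreFourierV_zero_alpha, one_div_one_sub_I_mul]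
  norm_num [Real.Gamma_one]

/-- The real and imaginary parts at `k = 0`: `∫_0^∞ e^{-x} cos(wx) dx = C_0 = 1/(1+w²)` and
`∫_0^∞ e^{-x} sin(wx) dx = S_0 = w/(1+w²)` (packaged as one complex identity
`∫_0^∞ e^{-x} e^{iwx} dx = C_0 + i S_0`). [cite: DavisRabinowitz1984, Sect. 3.9.1 (3.9.1.11)-(3.9.1.12)] -/
theorem integral_exp_neg_mul_cexp_eq_pattersonCS (w : ℝ) :
    ∫ x in Ioi (0 : ℝ), ((Real.exp (-x) : ℝ) : ℂ) * Complex.exp (Complex.I * w * x)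
      = (pattersonC w 0 : ℂ) + Complex.I * (pattersonS w 0 : ℂ) := by
  rw [integral_exp_neg_mul_cexp, pattersonCS_eq, one_div_one_sub_I_mul]
  simp

/-- **(3.9.1.2) proved at `k = 0`**: `∫ e^{-x²} e^{iwx} dx = π^{1/2} e^{-w²/4}` (the Fourier transform
of the Gaussian). [cite: DavisRabinowitz1984, Sect. 3.9.1 (3.9.1.2)] -/
theorem hermiteFourierClosedForm_zero (w : ℝ) : HermiteFourierClosedForm 0 w := by
  unfold HermiteFourierClosedForm hermiteFourierH hermiteFourierU
  have hb : (-1 : ℂ).re < 0 := by simp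
  have key := integral_cexp_quadratic hb (Complex.I * w) 0
  have : (fun x : ℝ => ((Real.exp (-x ^ 2) * (physHermite ℝ 0).eval x : ℝ) : ℂ)
      * Complex.exp (Complex.I * w * x))
      = fun x : ℝ => Complex.exp (-1 * (x : ℂ) ^ 2 + Complex.I * w * x + 0) := by
    funext x
    rw [physHermite_zero, Polynomial.eval_one, mul_one]
    push_cast
    rw [show -1 * (x : ℂ) ^ 2 + Complex.I * w * x + 0 = (-(x : ℂ) ^ 2) + (Complex.I * w * x) by ring,
      Complex.exp_add]
  have hsq : (Complex.I * (w : ℂ)) ^ 2 = -(w : ℂ) ^ 2 := by rw [mul_pow, Complex.I_sq]; ring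
  rw [this, key, hsq]
  simp only [pow_zero, one_mul, neg_neg, div_one, zero_sub, mul_one]
  congr 2
  ring

/-- `x ↦ x e^{-x² + iwx}` is integrable on `ℝ` (dominated by `|x| e^{-x²}`).
[cite: DavisRabinowitz1984, Sect. 3.9.1 (3.9.1.2)] -/
theorem integrable_mul_cexp_neg_sq_add (w : ℝ) :
    Integrable (fun x : ℝ => (x : ℂ) * Complex.exp (-1 * (x : ℂ) ^ 2 + Complex.I * w * x + 0)) := by
  have hg : Integrable (fun x : ℝ => x * Real.exp (-1 * x ^ 2)) :=
    integrable_mul_exp_neg_mul_sq one_pos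
  refine hg.norm.mono' ?_ (Filter.Eventually.of_forall fun x => ?_)
  · exact (Complex.continuous_ofReal.mul (Complex.continuous_exp.comp (by fun_prop))).aestronglyMeasurable
  · rw [norm_mul, Complex.norm_real, Complex.norm_exp, Real.norm_eq_abs, Real.norm_eq_abs,
      abs_mul, Real.abs_exp]
    gcongr
    apply le_of_eq
    simp [Complex.add_re, Complex.mul_re, Complex.I_re, Complex.I_im, pow_two]

/-- **(3.9.1.2) proved at `k = 1`**: `∫ e^{-x²} (2x) e^{iwx} dx = i π^{1/2} w e^{-w²/4}`
(from `∫ (d/dx)(-e^{-x² + iwx}) dx = 0`). [cite: DavisRabinowitz1984, Sect. 3.9.1 (3.9.1.2)] -/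
theorem hermiteFourierClosedForm_one (w : ℝ) : HermiteFourierClosedForm 1 w := by
  unfold HermiteFourierClosedForm hermiteFourierH hermiteFourierU
  have hb : (-1 : ℂ).re < 0 := by simp
  have hb' : (0 : ℝ) < (1 : ℂ).re := by simp
  have hgi : Integrable (fun x : ℝ => Complex.exp (-1 * (x : ℂ) ^ 2 + Complex.I * w * x + 0)) :=
    integrable_cexp_quadratic hb' (Complex.I * w) 0
  have hxg : Integrable (fun x : ℝ =>
      (x : ℂ) * Complex.exp (-1 * (x : ℂ) ^ 2 + Complex.I * w * x + 0)) :=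
    integrable_mul_cexp_neg_sq_add w
  -- the derivative of the exponent and of `-e^{-x² + iwx}`
  have hp : ∀ z : ℂ, HasDerivAt (fun z : ℂ => -1 * z ^ 2 + Complex.I * w * z + 0)
      (-1 * (2 * z) + Complex.I * w) z := by
    intro z
    have h := (((hasDerivAt_pow 2 z).const_mul (-1 : ℂ)).add
      ((hasDerivAt_id z).const_mul (Complex.I * w))).add_const (0 : ℂ)
    refine (h.congr_of_eventuallyEq (Filter.Eventually.of_forall fun y => rfl)).congr_deriv ?_
    norm_num
  have hderiv : ∀ x : ℝ, HasDerivAt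
      (fun y : ℝ => -Complex.exp (-1 * (y : ℂ) ^ 2 + Complex.I * w * y + 0))
      ((2 * (x : ℂ)) * Complex.exp (-1 * (x : ℂ) ^ 2 + Complex.I * w * x + 0)
        - Complex.I * w * Complex.exp (-1 * (x : ℂ) ^ 2 + Complex.I * w * x + 0)) x := by
    intro x
    have h3 := (((hp x).cexp).comp_ofReal).neg
    refine (h3.congr_of_eventuallyEq (Filter.Eventually.of_forall fun y => rfl)).congr_deriv ?_
    ring
  have h2xg : Integrable (fun x : ℝ =>
      (2 * (x : ℂ)) * Complex.exp (-1 * (x : ℂ) ^ 2 + Complex.I * w * x + 0)) :=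
    (hxg.const_mul 2).congr (Filter.Eventually.of_forall fun x => (mul_assoc _ _ _).symm)
  have hF' : Integrable (fun x : ℝ =>
      (2 * (x : ℂ)) * Complex.exp (-1 * (x : ℂ) ^ 2 + Complex.I * w * x + 0)
        - Complex.I * w * Complex.exp (-1 * (x : ℂ) ^ 2 + Complex.I * w * x + 0)) :=
    h2xg.sub (hgi.const_mul _)
  have hneg : Integrable (fun y : ℝ => -Complex.exp (-1 * (y : ℂ) ^ 2 + Complex.I * w * y + 0)) :=
    hgi.neg
  -- `∫ F' = 0`, i.e. `∫ 2x e^{…} = iw ∫ e^{…}`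
  have hzero := integral_eq_zero_of_hasDerivAt_of_integrable hderiv hF' hneg
  rw [integral_sub h2xg (hgi.const_mul _), sub_eq_zero, integral_const_mul] at hzero
  -- the integrand `e^{-x²} H_1(x) e^{iwx} = (2x) e^{-x² + iwx}`
  have hint : (fun x : ℝ => ((Real.exp (-x ^ 2) * (physHermite ℝ 1).eval x : ℝ) : ℂ)
      * Complex.exp (Complex.I * w * x))
      = fun x : ℝ => (2 * (x : ℂ)) * Complex.exp (-1 * (x : ℂ) ^ 2 + Complex.I * w * x + 0) := by
    funext x
    have he : (physHermite ℝ 1).eval x = 2 * x := by simp [physHermite_one]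
    rw [he]
    push_cast
    rw [show -1 * (x : ℂ) ^ 2 + Complex.I * w * x + 0 = (-(x : ℂ) ^ 2) + (Complex.I * w * x) by ring,
      Complex.exp_add]
    ring
  have hsq : (Complex.I * (w : ℂ)) ^ 2 = -(w : ℂ) ^ 2 := by rw [mul_pow, Complex.I_sq]; ring
  rw [hint, hzero, integral_cexp_quadratic hb (Complex.I * w) 0, hsq]
  simp only [pow_one, neg_neg, div_one, zero_sub]
  ring_nf

/-! ## The expansion coefficients and Patterson's approximations -/

/-- `b_k = ∫_0^∞ x^α e^{-x} L_k^{(α)}(x) f(x) dx` (3.9.1.6).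
[cite: DavisRabinowitz1984, Sect. 3.9.1 (3.9.1.6)] -/
noncomputable def laguerreExpansionCoeff (α : ℝ) (f : ℝ → ℝ) (k : ℕ) : ℝ :=
  ∫ x in Ioi (0 : ℝ), x ^ α * Real.exp (-x) * (laguerre α k).eval x * f x

/-- `q_k = (1/(2^k k!)) ∫ e^{-x²} H_k(x) f(x) dx` (3.9.1.9).
[cite: DavisRabinowitz1984, Sect. 3.9.1 (3.9.1.9)] -/
noncomputable def hermiteExpansionCoeff (f : ℝ → ℝ) (k : ℕ) : ℝ :=
  (1 / (2 ^ k * (k.factorial : ℝ))) * ∫ x : ℝ, Real.exp (-x ^ 2) * (physHermite ℝ k).eval x * f x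

/-- Patterson's approximation `L(w) ≈ Σ_{k ≤ n} b_k V_k(w)` (3.9.1.7).
[cite: DavisRabinowitz1984, Sect. 3.9.1 (3.9.1.7)] -/
noncomputable def pattersonLaguerreApprox (α : ℝ) (f : ℝ → ℝ) (n : ℕ) (w : ℝ) : ℂ :=
  ∑ k ∈ Finset.range (n + 1), (laguerreExpansionCoeff α f k : ℂ) * laguerreFourierV α k w

/-- Patterson's approximation `H(w) ≈ e^{-w²/4} Σ_{k ≤ n} i^k q_k w^k` (3.9.1.10).
[cite: DavisRabinowitz1984, Sect. 3.9.1 (3.9.1.10)] -/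
noncomputable def pattersonHermiteApprox (f : ℝ → ℝ) (n : ℕ) (w : ℝ) : ℂ :=
  Complex.exp (-(w : ℂ) ^ 2 / 4) *
    ∑ k ∈ Finset.range (n + 1), Complex.I ^ k * (hermiteExpansionCoeff f k : ℂ) * (w : ℂ) ^ k

/-- `I_c ≈ Σ b_k C_k` (3.9.1.11). [cite: DavisRabinowitz1984, Sect. 3.9.1 (3.9.1.11)] -/
noncomputable def pattersonCosApprox (f : ℝ → ℝ) (n : ℕ) (w : ℝ) : ℝ :=
  ∑ k ∈ Finset.range (n + 1), laguerreExpansionCoeff 0 f k * pattersonC w k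

/-- `I_s ≈ Σ b_k S_k` (3.9.1.12). [cite: DavisRabinowitz1984, Sect. 3.9.1 (3.9.1.12)] -/
noncomputable def pattersonSinApprox (f : ℝ → ℝ) (n : ℕ) (w : ℝ) : ℝ :=
  ∑ k ∈ Finset.range (n + 1), laguerreExpansionCoeff 0 f k * pattersonS w k

/-- **(3.9.1.11)–(3.9.1.12) are the real and imaginary parts of (3.9.1.7) at `α = 0`**:
`Σ b_k V_k(w) = Σ b_k C_k + i Σ b_k S_k`. [cite: DavisRabinowitz1984, Sect. 3.9.1 (3.9.1.11)-(3.9.1.12)] -/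
theorem pattersonLaguerreApprox_zero_eq (f : ℝ → ℝ) (n : ℕ) (w : ℝ) :
    pattersonLaguerreApprox 0 f n w
      = (pattersonCosApprox f n w : ℂ) + Complex.I * (pattersonSinApprox f n w : ℂ) := by
  unfold pattersonLaguerreApprox pattersonCosApprox pattersonSinApprox
  push_cast
  rw [Finset.mul_sum, ← Finset.sum_add_distrib]
  refine Finset.sum_congr rfl (fun k _ => ?_)
  rw [laguerreFourierV_zero_alpha, ← pattersonCS_eq]
  ring

/-- (3.9.1.8) + (3.9.1.2) ⇒ (3.9.1.10): `π^{-1/2} Σ q_k U_k(w) = e^{-w²/4} Σ i^k q_k w^k`.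
[cite: DavisRabinowitz1984, Sect. 3.9.1 (3.9.1.10)] -/
theorem pattersonHermiteApprox_eq (f : ℝ → ℝ) (n : ℕ) (w : ℝ) :
    ((Real.pi : ℂ) ^ (1 / 2 : ℂ))⁻¹ * ∑ k ∈ Finset.range (n + 1), (hermiteExpansionCoeff f k : ℂ) * hermiteFourierU k w
      = pattersonHermiteApprox f n w := by
  unfold pattersonHermiteApprox hermiteFourierU
  have hpi : ((Real.pi : ℂ) ^ (1 / 2 : ℂ)) ≠ 0 := by
    rw [Ne, Complex.cpow_eq_zero_iff, not_and_or]
    left; exact_mod_cast Real.pi_ne_zero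
  rw [Finset.mul_sum, Finset.mul_sum]
  refine Finset.sum_congr rfl (fun k _ => ?_)
  field_simp

end Literature.Analysis.Quadrature

/-! ## Proof of (3.9.1.2) for every `k` (`HermiteFourierClosedForm_holds`)

The named fact `HermiteFourierClosedForm k w` is discharged for all `k, w`: by the adjoint relation
`H_{k+1}(x) = -e^{x²} (d/dx)[e^{-x²} H_k(x)]` ([Ismail2005, (4.6.21)], obtained here from the
three-term recurrence defining `physHermite` via `H_{n+1}' = 2(n+1) H_n`, [Ismail2005, (4.6.20)]),
one integration by parts (`∫ F' = 0` for the integrable `F(x) = H_k(x) e^{-x² + iwx}` with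
integrable derivative) gives `U_{k+1}(w) = iw U_k(w)`, and the closed form
`i^k π^{1/2} w^k e^{-w²/4}` satisfies the same recurrence; the base case is the Gaussian Fourier
transform `hermiteFourierClosedForm_zero` above.
-/

namespace Literature.Analysis.Quadrature

open Polynomial

open Literature.Combinatorics.Enumerative.HermiteBilinearGeneratingFunction
  (physHermite physHermite_zero physHermite_one physHermite_add_two)

section HermiteFourierProof

/-! ### The derivative of the physicists' Hermite polynomials -/

/-- `H_{n+1}' = 2(n+1) H_n` (from the three-term recurrence, by induction). [cite: Ismail2005, (4.6.20)] -/
theorem derivative_physHermite_succ {R : Type*} [CommRing R] (n : ℕ) :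
    derivative (physHermite R (n + 1)) = 2 * ((n : R[X]) + 1) * physHermite R n := by
  induction n using Nat.twoStepInduction with
  | zero =>
    rw [physHermite_one, physHermite_zero, derivative_mul, derivative_X]
    simp
  | one =>
    rw [show (1 + 1 : ℕ) = 0 + 2 from rfl, physHermite_add_two, physHermite_one, physHermite_zero]
    simp only [derivative_sub, derivative_mul, derivative_X, derivative_natCast, derivative_ofNat,
      derivative_one]
    push_cast
    ring
  | more n ih0 ih1 =>
    rw [show n + 2 + 1 = (n + 1) + 2 from rfl, physHermite_add_two (R := R) (n + 1)]
    simp only [derivative_sub, derivative_mul, derivative_X, derivative_natCast, derivative_ofNat]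
    rw [ih1, ih0, show n + 1 + 1 = n + 2 from rfl]
    have hrec := physHermite_add_two (R := R) n
    push_cast at hrec ⊢
    linear_combination (-2 * ((n : R[X]) + 2)) * hrec

/-- The adjoint relation `H_{k+1} = 2x H_k - H_k'`, i.e. `H_{k+1} = -e^{x²} (d/dx)[e^{-x²} H_k]`.
[cite: Ismail2005, (4.6.21)] -/
theorem physHermite_succ_eq_sub_derivative {R : Type*} [CommRing R] (k : ℕ) :
    physHermite R (k + 1) = 2 * X * physHermite R k - derivative (physHermite R k) := by
  cases k with
  | zero => simp [physHermite_one, physHermite_zero]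
  | succ m =>
    rw [show m + 1 + 1 = m + 2 from rfl, physHermite_add_two, derivative_physHermite_succ]
    push_cast
    ring

/-! ### Integrability of polynomials against the Gaussian
(`x^i e^{-x²}` is integrable: `integrable_pow_mul_exp_neg_sq` of `GaussLaguerreHermiteLowOrder`) -/

/-- `P(x) e^{-x²}` is integrable on `ℝ` for every real polynomial `P`. [folklore] -/
private theorem integrable_polynomial_mul_exp_neg_sq (P : ℝ[X]) :
    Integrable (fun x : ℝ => P.eval x * Real.exp (-x ^ 2)) := by
  have : (fun x : ℝ => P.eval x * Real.exp (-x ^ 2)) =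
      fun x : ℝ => ∑ i ∈ Finset.range (P.natDegree + 1), P.coeff i * (x ^ i * Real.exp (-x ^ 2)) := by
    funext x
    rw [Polynomial.eval_eq_sum_range, Finset.sum_mul]
    simp only [mul_assoc]
  rw [this]
  exact integrable_finsetSum _ fun i _ => (integrable_pow_mul_exp_neg_sq i).const_mul _

/-- The complex integrand `P(x) e^{-x² + iwx}` is integrable for every real polynomial `P`.
[folklore] -/
private theorem integrable_polynomial_mul_cexp (P : ℝ[X]) (w : ℝ) :
    Integrable (fun x : ℝ => ((P.eval x : ℝ) : ℂ) *
      Complex.exp (-(x : ℂ) ^ 2 + Complex.I * w * x)) := by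
  refine (integrable_polynomial_mul_exp_neg_sq P).norm.mono' ?_
    (Filter.Eventually.of_forall fun x => ?_)
  · exact (Complex.continuous_ofReal.comp (P.continuous)).mul
      (Complex.continuous_exp.comp (by fun_prop)) |>.aestronglyMeasurable
  · have hre : (-(x : ℂ) ^ 2 + Complex.I * w * x).re = -x ^ 2 := by
      simp [Complex.add_re, Complex.mul_re, Complex.I_re, Complex.I_im, pow_two]
    simp only [norm_mul, Complex.norm_real, Complex.norm_exp, hre, Real.norm_eq_abs, Real.abs_exp]
    exact le_rfl

/-! ### One integration by parts: `U_{k+1}(w) = iw U_k(w)` -/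

/-- The integrand of `U_k(w)` in the form `H_k(x) e^{-x² + iwx}`. [folklore] -/
private theorem hermiteFourierH_integrand (k : ℕ) (w x : ℝ) :
    ((Real.exp (-x ^ 2) * (physHermite ℝ k).eval x : ℝ) : ℂ) * Complex.exp (Complex.I * w * x) =
      (((physHermite ℝ k).eval x : ℝ) : ℂ) * Complex.exp (-(x : ℂ) ^ 2 + Complex.I * w * x) := by
  rw [Complex.exp_add]
  push_cast
  ring

/-- **The recurrence `U_{k+1}(w) = iw U_k(w)`**: since `e^{-x²} H_{k+1}(x) = -(d/dx)(e^{-x²} H_k(x))`,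
an integration by parts (`∫ F' = 0` for `F = H_k e^{-x² + iwx}`) gives
`∫ e^{-x²} H_{k+1} e^{iwx} = iw ∫ e^{-x²} H_k e^{iwx}`. [cite: DavisRabinowitz1984, Sect. 3.9.1 (3.9.1.2)] -/
theorem hermiteFourierH_succ (k : ℕ) (w : ℝ) :
    hermiteFourierH (fun x => (physHermite ℝ (k + 1)).eval x) w =
      Complex.I * w * hermiteFourierH (fun x => (physHermite ℝ k).eval x) w := by
  unfold hermiteFourierH
  simp_rw [hermiteFourierH_integrand]
  set E : ℝ → ℂ := fun x => Complex.exp (-(x : ℂ) ^ 2 + Complex.I * w * x) with hE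
  set P := physHermite ℝ k with hP
  -- derivative of the exponent
  have hp : ∀ z : ℂ, HasDerivAt (fun z : ℂ => -z ^ 2 + Complex.I * w * z)
      (-(2 * z) + Complex.I * w) z := by
    intro z
    have h := ((hasDerivAt_pow 2 z).neg).add ((hasDerivAt_id z).const_mul (Complex.I * w))
    refine (h.congr_of_eventuallyEq (Filter.Eventually.of_forall fun y => rfl)).congr_deriv ?_
    simp
  have hEd : ∀ x : ℝ, HasDerivAt E ((-(2 * (x : ℂ)) + Complex.I * w) * E x) x := by
    intro x
    have h3 := ((hp x).cexp).comp_ofReal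
    refine (h3.congr_of_eventuallyEq (Filter.Eventually.of_forall fun y => rfl)).congr_deriv ?_
    rw [hE]; ring
  have hPd : ∀ x : ℝ, HasDerivAt (fun y : ℝ => ((P.eval y : ℝ) : ℂ))
      (((derivative P).eval x : ℝ) : ℂ) x := fun x => (P.hasDerivAt x).ofReal_comp
  -- `F = P · E`, `F' = -H_{k+1} E + iw F`
  have hderiv : ∀ x : ℝ, HasDerivAt (fun y : ℝ => ((P.eval y : ℝ) : ℂ) * E y)
      (-((((physHermite ℝ (k + 1)).eval x : ℝ) : ℂ) * E x) +
        Complex.I * w * ((((P.eval x : ℝ) : ℂ)) * E x)) x := by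
    intro x
    refine ((hPd x).mul (hEd x)).congr_deriv ?_
    rw [hP, physHermite_succ_eq_sub_derivative, eval_sub, eval_mul, eval_mul, eval_X]
    push_cast
    simp only [Polynomial.eval_ofNat]
    push_cast
    ring
  have hF : Integrable (fun y : ℝ => ((P.eval y : ℝ) : ℂ) * E y) := integrable_polynomial_mul_cexp P w
  have hF1 : Integrable (fun x : ℝ => (((physHermite ℝ (k + 1)).eval x : ℝ) : ℂ) * E x) :=
    integrable_polynomial_mul_cexp _ w
  have hF1neg : Integrable (fun x : ℝ => -((((physHermite ℝ (k + 1)).eval x : ℝ) : ℂ) * E x)) :=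
    hF1.neg
  have hF' : Integrable (fun x : ℝ => -((((physHermite ℝ (k + 1)).eval x : ℝ) : ℂ) * E x) +
      Complex.I * w * ((((P.eval x : ℝ) : ℂ)) * E x)) := hF1neg.add (hF.const_mul _)
  have hzero := integral_eq_zero_of_hasDerivAt_of_integrable hderiv hF' hF
  rw [integral_add hF1neg (hF.const_mul _), integral_neg, integral_const_mul,
    neg_add_eq_zero] at hzero
  exact hzero

/-- The closed form satisfies the same recurrence: `U_{k+1}(w) = iw · U_k(w)`.
[cite: DavisRabinowitz1984, Sect. 3.9.1 (3.9.1.2)] -/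
theorem hermiteFourierU_succ (k : ℕ) (w : ℝ) :
    hermiteFourierU (k + 1) w = Complex.I * w * hermiteFourierU k w := by
  unfold hermiteFourierU
  ring

/-- **(3.9.1.2) for every `k`**: `U_k(w) = ∫ e^{-x²} H_k(x) e^{iwx} dx = i^k π^{1/2} w^k e^{-w²/4}`,
by induction on `k` from the Gaussian Fourier transform (`k = 0`) and the recurrence
`U_{k+1} = iw U_k` (integration by parts). Discharge of the named fact `HermiteFourierClosedForm`.
[cite: DavisRabinowitz1984, Sect. 3.9.1 (3.9.1.2)] -/
theorem HermiteFourierClosedForm_holds : ∀ (k : ℕ) (w : ℝ), HermiteFourierClosedForm k w := by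
  intro k w
  induction k with
  | zero => exact hermiteFourierClosedForm_zero w
  | succ k ih =>
    unfold HermiteFourierClosedForm at ih ⊢
    rw [hermiteFourierH_succ, ih, hermiteFourierU_succ]

end HermiteFourierProof

end Literature.Analysis.Quadrature
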